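import Literature.NumberTheory.Automorphic.JacquetLanglandsTransfer
import Literature.NumberTheory.Automorphic.JacquetLanglandsLocalSatake
import Literature.NumberTheory.Automorphic.GLnCuspidalSpectrumFlathProofs
import HarnessLib

/-!
# The existence of the Jacquet–Langlands transfer `D^× → GL₂`: second decomposition layer

Topic `NumberTheory/Automorphic`; proof-only sibling of
`Literature.NumberTheory.Automorphic.JacquetLanglandsTransfer` (no definition, no named fact).

That file reduces the named fact `jacquetLanglands_transfer_exists K D` of `JacquetLanglandsParts`
(Gelbart (1975), Thm. 10.5 (i) with Thm. 7.6 (ii); Jacquet–Langlands, LNM 114, Thm. 14.4 with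
Thm. 15.1) to the printed transfer theorem in Satake-parameter form (the explicit hypothesis `hT`
of `jacquetLanglands_transfer_exists_of_Gelbart1975`; formerly the named fact
`Gelbart1975_jacquetLanglands_transfer`, merged back into the parent's proof obligation by the
D-0026 review recorded in that file — here too it is an explicit hypothesis, written out in full)
**plus** Flath's uniqueness of local components (`nonempty_equiv_of_hasLocalComponentAt`), carried
as the hypothesis `hU` of `jacquetLanglands_transfer_exists_of_Gelbart1975`. Two inputs have since
become theorems of the tree, and this file cashes them in:

1. `nonempty_equiv_of_hasLocalComponentAt_holds` (`GLnCuspidalSpectrumFlathProofs`): Flath's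
   uniqueness of the irreducible admissible local components of a cuspidal `Π ≤ L²_cusp` is
   proved, so `jacquetLanglands_transfer_exists_of_Gelbart1975'` has the printed theorem as its
   **only** hypothesis;
2. `heckeCompatibleAway_of_localComponents` (`JacquetLanglandsLocalSatake`): matching irreducible
   smooth local components at the places `v ∉ S` (through the splittings `φ_v`) imply the
   Satake-parameter matching `HeckeCompatibleAway S φ πD Π` — the "folklore semantics" in which
   `JacquetLanglandsParts` had to state the transfer. Hence
   `Gelbart1975_jacquetLanglands_transfer_of_localComponents`: the Satake-parameter form of the
   transfer theorem follows from **Gelbart's own formulation** (hypothesis `hA`, written out in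
   full, exactly as in the tree's `jacquetLanglands_transfer_surjective_of_localComponents` for
   the "onto" half): for every automorphic `πD ≤ L²(D_𝔸ˣ ⧸ ℝ_{>0} Dˣ)` of dimension `> 1` there is
   a cuspidal `Π` of `GL₂(𝔸_K)` which (i) at every split finite place `v`, through every splitting
   `θ_v : D_v ≃ₐ M₂(K_v)`, has the same irreducible smooth local components as `πD` — "the
   representation of `G_𝔸 = GL(2, 𝔸)` whose `v`-th component is equivalent to `π'_v` if `v ∉ S`
   … is a cusp form" (Thm. 10.5 (i), p. 148) — and (ii) at every `v ∈ Ram_f(D)` has an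
   irreducible admissible local component which is square-integrable modulo the centre — "such
   that `π_v` is square-integrable for each `v ∈ S`" (p. 149), `π_v = π_v(π'_v)` being "absolutely
   cuspidal if `d > 1` and special if `d = 1`" (Thm. 7.6 (ii), p. 92).

`jacquetLanglands_transfer_exists_of_localComponents` composes the two: the vendored fact
`jacquetLanglands_transfer_exists K D` follows from `hA` alone. What remains under it is therefore
exactly the printed Theorem 10.5 (i) (with the square-integrability clause of (ii)) in the
language of local components — whose proof is either the converse-theorem route (Gelbart
pp. 149–150 after Jacquet–Langlands §14: local zeta integrals on `D_v`, `L(π'_v, s) = L(π_v(π'_v), s)`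
and the `ε`-identity (10.6)–(10.7), Tate's method on the compact quotient `Z_𝔸 G'_F \ G'_𝔸`, the
converse theorem Thm. 6.18) or the trace-formula route (pp. 150–155: the character identity
(10.8), Lemma 10.6, (10.10)–(10.22), Remark 10.7). Per the fact-decomposition discipline (D-0026)
`hA` is **not** introduced as a named fact; it is an explicit hypothesis.

## Design notes

* Theorems only; no named fact (D-0026): both the Satake-parameter form `hT` and the
  local-component form `hA` of the printed theorem are explicit hypotheses. `hA` copies the binder
  shapes of `hT` (division hypothesis, automorphic measures, Borel structures on `PGL₂(K_v)` as
  instance binders); its clause (i) quantifies over local spaces `V : Type u` (`u` the universe of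
  `D`, as in `heckeCompatibleAway_of_localComponents`), its clause (ii) over `V : Type` (as in
  `hT`).
* Clause (i) is an `↔` of `HasLocalComponentAt Π v ρ` and `HasLocalComponentAtD (unitsEquivOfSplitting θ) πD ρ`
  for irreducible *smooth* `ρ` — the faithful rendering of "`π_v ≅ π'_v`" discussed in the module
  docstring of `JacquetLanglandsLocalSatake` (for `GL₂` over a local field irreducible smooth is
  irreducible admissible).

## References

* S. Gelbart, *Automorphic forms on adele groups*, Ann. of Math. Studies 83 (1975), Thm. 7.6
  (p. 92), Thm. 10.5 (pp. 148–149) and its two proofs (pp. 149–156) [Gelbart1975].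
* H. Jacquet, R. P. Langlands, *Automorphic forms on GL(2)*, LNM 114 (1970), Thm. 14.4, §15,
  Thm. 16.1 [JacquetLanglands1970].
* D. Flath, *Decomposition of representations into tensor products*, Proc. Sympos. Pure Math.
  33.1 (1979), Thm. 3–4 [Flath1979].
-/

noncomputable section

open scoped TensorProduct MatrixGroups NNReal
open NumberField IsDedekindDomain MeasureTheory
open Literature.NumberTheory.Automorphic

universe u

namespace Literature.NumberTheory.Automorphic

section Assembly

variable (K : Type) [Field K] [NumberField K] (D : Type u) [Ring D] [Algebra K D]
  [IsQuaternionAlgebra K D]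

/-- **The printed transfer theorem alone implies `jacquetLanglands_transfer_exists`.** The
hypothesis `hT` is Gelbart (1975), Thm. 10.5 (i) (with the square-integrability clause of (ii))
in Satake-parameter form, exactly the hypothesis `hT` of
`jacquetLanglands_transfer_exists_of_Gelbart1975` (`JacquetLanglandsTransfer`, whose docstring
spells out the reading); the other hypothesis `hU` there (Flath's uniqueness of local components)
is the theorem `nonempty_equiv_of_hasLocalComponentAt_holds` of `GLnCuspidalSpectrumFlathProofs`
(Flath (1979), Thm. 3; there proved by a Hilbert-space argument), taken at the universe of the
local spaces of the statement. [cite: Gelbart1975, Thm. 10.5 (i)] -/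
theorem jacquetLanglands_transfer_exists_of_Gelbart1975'
    (hT : ∀ (_hdiv : ∀ x : D, x ≠ 0 → IsUnit x)
      (μ_D : Measure (AdelicGroupData.units K D).automorphicQuotient)
      [(AdelicGroupData.units K D).IsAutomorphicMeasure μ_D]
      (μ : Measure (AdelicGroupData.gl 2 K).automorphicQuotient)
      [(AdelicGroupData.gl 2 K).IsAutomorphicMeasure μ]
      [∀ v : HeightOneSpectrum (𝓞 K), MeasurableSpace (GL (Fin 2) (v.adicCompletion K) ⧸
        Subgroup.center (GL (Fin 2) (v.adicCompletion K)))]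
      [∀ v : HeightOneSpectrum (𝓞 K), BorelSpace (GL (Fin 2) (v.adicCompletion K) ⧸
        Subgroup.center (GL (Fin 2) (v.adicCompletion K)))]
      (πD : DiscreteAutomorphicRep (AdelicGroupData.units K D) μ_D), ¬ πD.IsOneDimensional →
      ∃ π : CuspidalAutomorphicRepGL 2 K μ,
        (∀ (S : Finset (HeightOneSpectrum (𝓞 K)))
            (φ : ∀ v, v ∉ S → (ScalarExtension K (v.adicCompletion K) D ≃ₐ[v.adicCompletion K]
              Matrix (Fin 2) (Fin 2) (v.adicCompletion K))),
            HeckeCompatibleAway S φ πD π) ∧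
        (∀ v ∈ ramifiedPlaces K D, ∃ (V : Type) (_ : AddCommGroup V) (_ : Module ℂ V)
            (ρ : Representation ℂ (GL (Fin 2) (v.adicCompletion K)) V),
            ρ.IsIrreducible ∧ ρ.IsAdmissible ∧ HasLocalComponentAt π.1 v ρ ∧
              ∀ (ν : Measure (GL (Fin 2) (v.adicCompletion K) ⧸
                Subgroup.center (GL (Fin 2) (v.adicCompletion K)))) [ν.IsHaarMeasure],
                ρ.IsSquareIntegrableModCenter ν)) :
    jacquetLanglands_transfer_exists K D :=
  jacquetLanglands_transfer_exists_of_Gelbart1975 K D hT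
    fun _ _ => nonempty_equiv_of_hasLocalComponentAt_holds

/-- **The transfer theorem, Satake-parameter form, from its local-component form.** Suppose
Gelbart's Theorem 10.5 (i) (with the square-integrability clause of (ii)) in the language of
local components (`hA`): for `D` a division quaternion algebra over `K` and every automorphic
`πD ≤ L²(D_𝔸ˣ ⧸ ℝ_{>0} Dˣ)` of dimension `> 1` there is a cuspidal `Π` of `GL₂(𝔸_K)` which
(i) at every split finite place `v`, through every splitting `θ_v : D_v ≃ₐ M₂(K_v)`, has the same
irreducible smooth local components as `πD` ("whose `v`-th component is equivalent to `π'_v` if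
`v ∉ S` … `π = ⊗ π_v` is a cusp form for `G_𝔸`", Gelbart (1975), Thm. 10.5 (i), p. 148) and
(ii) at every `v ∈ Ram_f(D)` has an irreducible admissible local component which is
square-integrable modulo the centre for every Haar measure on `PGL₂(K_v)` ("such that `π_v` is
square-integrable for each `v ∈ S`", p. 149; Thm. 7.6 (ii), p. 92). Then the Satake-parameter
form of the theorem (the hypothesis `hT` of `jacquetLanglands_transfer_exists_of_Gelbart1975`)
holds: clause (a), the Hecke compatibility away from every finite `S` through all splittings `φ_v`
(`v ∉ S`), is `heckeCompatibleAway_of_localComponents` applied to (i) at the splittings `φ_v`;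
clause (b∃) is (ii) verbatim. [cite: Gelbart1975, Thm. 10.5 (i)–(ii), pp. 148–149] -/
theorem Gelbart1975_jacquetLanglands_transfer_of_localComponents
    (hA : ∀ (_hdiv : ∀ x : D, x ≠ 0 → IsUnit x)
      (μ_D : Measure (AdelicGroupData.units K D).automorphicQuotient)
      [(AdelicGroupData.units K D).IsAutomorphicMeasure μ_D]
      (μ : Measure (AdelicGroupData.gl 2 K).automorphicQuotient)
      [(AdelicGroupData.gl 2 K).IsAutomorphicMeasure μ]
      [∀ v : HeightOneSpectrum (𝓞 K), MeasurableSpace (GL (Fin 2) (v.adicCompletion K) ⧸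
        Subgroup.center (GL (Fin 2) (v.adicCompletion K)))]
      [∀ v : HeightOneSpectrum (𝓞 K), BorelSpace (GL (Fin 2) (v.adicCompletion K) ⧸
        Subgroup.center (GL (Fin 2) (v.adicCompletion K)))]
      (πD : DiscreteAutomorphicRep (AdelicGroupData.units K D) μ_D), ¬ πD.IsOneDimensional →
      ∃ π : CuspidalAutomorphicRepGL 2 K μ,
        (∀ (v : HeightOneSpectrum (𝓞 K))
            (θ : ScalarExtension K (v.adicCompletion K) D ≃ₐ[v.adicCompletion K]
              Matrix (Fin 2) (Fin 2) (v.adicCompletion K))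
            (V : Type u) [AddCommGroup V] [Module ℂ V]
            (ρ : Representation ℂ (GL (Fin 2) (v.adicCompletion K)) V),
            ρ.IsIrreducible → ρ.IsSmooth →
              (HasLocalComponentAt π.1 v ρ ↔
                HasLocalComponentAtD (unitsEquivOfSplitting θ) πD.space ρ)) ∧
        (∀ v ∈ ramifiedPlaces K D, ∃ (V : Type) (_ : AddCommGroup V) (_ : Module ℂ V)
            (ρ : Representation ℂ (GL (Fin 2) (v.adicCompletion K)) V),
            ρ.IsIrreducible ∧ ρ.IsAdmissible ∧ HasLocalComponentAt π.1 v ρ ∧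
              ∀ (ν : Measure (GL (Fin 2) (v.adicCompletion K) ⧸
                Subgroup.center (GL (Fin 2) (v.adicCompletion K)))) [ν.IsHaarMeasure],
                ρ.IsSquareIntegrableModCenter ν)) :
    ∀ (_hdiv : ∀ x : D, x ≠ 0 → IsUnit x)
      (μ_D : Measure (AdelicGroupData.units K D).automorphicQuotient)
      [(AdelicGroupData.units K D).IsAutomorphicMeasure μ_D]
      (μ : Measure (AdelicGroupData.gl 2 K).automorphicQuotient)
      [(AdelicGroupData.gl 2 K).IsAutomorphicMeasure μ]
      [∀ v : HeightOneSpectrum (𝓞 K), MeasurableSpace (GL (Fin 2) (v.adicCompletion K) ⧸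
        Subgroup.center (GL (Fin 2) (v.adicCompletion K)))]
      [∀ v : HeightOneSpectrum (𝓞 K), BorelSpace (GL (Fin 2) (v.adicCompletion K) ⧸
        Subgroup.center (GL (Fin 2) (v.adicCompletion K)))]
      (πD : DiscreteAutomorphicRep (AdelicGroupData.units K D) μ_D), ¬ πD.IsOneDimensional →
      ∃ π : CuspidalAutomorphicRepGL 2 K μ,
        (∀ (S : Finset (HeightOneSpectrum (𝓞 K)))
            (φ : ∀ v, v ∉ S → (ScalarExtension K (v.adicCompletion K) D ≃ₐ[v.adicCompletion K]
              Matrix (Fin 2) (Fin 2) (v.adicCompletion K))),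
            HeckeCompatibleAway S φ πD π) ∧
        (∀ v ∈ ramifiedPlaces K D, ∃ (V : Type) (_ : AddCommGroup V) (_ : Module ℂ V)
            (ρ : Representation ℂ (GL (Fin 2) (v.adicCompletion K)) V),
            ρ.IsIrreducible ∧ ρ.IsAdmissible ∧ HasLocalComponentAt π.1 v ρ ∧
              ∀ (ν : Measure (GL (Fin 2) (v.adicCompletion K) ⧸
                Subgroup.center (GL (Fin 2) (v.adicCompletion K)))) [ν.IsHaarMeasure],
                ρ.IsSquareIntegrableModCenter ν) := by
  intro hdiv μ_D _ μ _ _ _ πD hπD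
  obtain ⟨π, hloc, hsq⟩ := hA hdiv μ_D μ πD hπD
  exact ⟨π, fun S φ => heckeCompatibleAway_of_localComponents πD π S φ
    fun v hv V _ _ ρ hi hs => hloc v (φ v hv) V ρ hi hs, hsq⟩

/-- **`jacquetLanglands_transfer_exists` from the local-component form of the transfer
theorem.** Composition of `Gelbart1975_jacquetLanglands_transfer_of_localComponents` (the
Satake-parameter semantics, `JacquetLanglandsLocalSatake`) and
`jacquetLanglands_transfer_exists_of_Gelbart1975'` (Flath's uniqueness of local components,
`GLnCuspidalSpectrumFlathProofs`, and the transport of square-integrability modulo the centre,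
`JacquetLanglandsTransfer`): the vendored existence half of the global Jacquet–Langlands
correspondence is reduced to Gelbart's Theorem 10.5 (i) (with the square-integrability clause of
(ii)) as printed, in the language of local components. [cite: Gelbart1975, Thm. 10.5 (i)–(ii), pp. 148–149] -/
theorem jacquetLanglands_transfer_exists_of_localComponents
    (hA : ∀ (_hdiv : ∀ x : D, x ≠ 0 → IsUnit x)
      (μ_D : Measure (AdelicGroupData.units K D).automorphicQuotient)
      [(AdelicGroupData.units K D).IsAutomorphicMeasure μ_D]
      (μ : Measure (AdelicGroupData.gl 2 K).automorphicQuotient)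
      [(AdelicGroupData.gl 2 K).IsAutomorphicMeasure μ]
      [∀ v : HeightOneSpectrum (𝓞 K), MeasurableSpace (GL (Fin 2) (v.adicCompletion K) ⧸
        Subgroup.center (GL (Fin 2) (v.adicCompletion K)))]
      [∀ v : HeightOneSpectrum (𝓞 K), BorelSpace (GL (Fin 2) (v.adicCompletion K) ⧸
        Subgroup.center (GL (Fin 2) (v.adicCompletion K)))]
      (πD : DiscreteAutomorphicRep (AdelicGroupData.units K D) μ_D), ¬ πD.IsOneDimensional →
      ∃ π : CuspidalAutomorphicRepGL 2 K μ,
        (∀ (v : HeightOneSpectrum (𝓞 K))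
            (θ : ScalarExtension K (v.adicCompletion K) D ≃ₐ[v.adicCompletion K]
              Matrix (Fin 2) (Fin 2) (v.adicCompletion K))
            (V : Type u) [AddCommGroup V] [Module ℂ V]
            (ρ : Representation ℂ (GL (Fin 2) (v.adicCompletion K)) V),
            ρ.IsIrreducible → ρ.IsSmooth →
              (HasLocalComponentAt π.1 v ρ ↔
                HasLocalComponentAtD (unitsEquivOfSplitting θ) πD.space ρ)) ∧
        (∀ v ∈ ramifiedPlaces K D, ∃ (V : Type) (_ : AddCommGroup V) (_ : Module ℂ V)
            (ρ : Representation ℂ (GL (Fin 2) (v.adicCompletion K)) V),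
            ρ.IsIrreducible ∧ ρ.IsAdmissible ∧ HasLocalComponentAt π.1 v ρ ∧
              ∀ (ν : Measure (GL (Fin 2) (v.adicCompletion K) ⧸
                Subgroup.center (GL (Fin 2) (v.adicCompletion K)))) [ν.IsHaarMeasure],
                ρ.IsSquareIntegrableModCenter ν)) :
    jacquetLanglands_transfer_exists K D :=
  jacquetLanglands_transfer_exists_of_Gelbart1975' K D
    (Gelbart1975_jacquetLanglands_transfer_of_localComponents K D hA)

end Assembly

end Literature.NumberTheory.Automorphic
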